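import Literature.Analysis.FluidPDE.ElgindiOperatorLocality
import HarnessLib

/-!
# Locality of the words `D_z^k`, `∂_θ^n`, `D_θ^n` on open sets
([ElgindiGhoulMasmoudi2021] §1.7: the operators `D_z = z∂_z`, `D_θ = sin(2θ)∂_θ`)

Topic `Literature/Analysis/FluidPDE`. Proof file (everything proved, no definitions, no named
facts) on the proof path of the named fact
`Literature.Analysis.FluidPDE.Elgindi.ElgindiGhoulMasmoudi2021_stabilityCore`
(`ElgindiStabilityDecomposition.lean`). Elgindi–Ghoul–Masmoudi, arXiv:1910.14071, §1.7 (p. 6).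

Functions that agree on an open set have equal iterates of `D_z`, `∂_θ`, `D_θ` there
(`iterate_Dz_congr_open`, `iterate_dθ_congr_open`, `iterate_Dθ_congr_open`): the slice derivatives
only see a neighbourhood.
-/

noncomputable section

open Set Function Real Filter
open _root_.Topology

namespace Literature.Analysis.FluidPDE

namespace Elgindi

/-- Locality of `D_R`-iterates on open sets. [folklore] -/
theorem iterate_Dz_congr_open {f g : ℝ → ℝ → ℝ} {W : Set (ℝ × ℝ)} (hW : IsOpen W) (h : ∀ q ∈ W, f q.1 q.2 = g q.1 q.2) (k : ℕ) :
    ∀ q ∈ W, (Dz^[k] f) q.1 q.2 = (Dz^[k] g) q.1 q.2 := by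
  induction k generalizing f g with
  | zero => exact h
  | succ k ih =>
    intro q hq
    rw [Function.iterate_succ_apply, Function.iterate_succ_apply]
    refine ih (fun r hr => ?_) q hq
    show r.1 * dz f r.1 r.2 = r.1 * dz g r.1 r.2
    rw [eqOn_dz hW h hr]

/-- Locality of `∂_θ`-iterates on open sets. [folklore] -/
theorem iterate_dθ_congr_open {f g : ℝ → ℝ → ℝ} {W : Set (ℝ × ℝ)} (hW : IsOpen W) (h : ∀ q ∈ W, f q.1 q.2 = g q.1 q.2) (n : ℕ) :
    ∀ q ∈ W, (dθ^[n] f) q.1 q.2 = (dθ^[n] g) q.1 q.2 := by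
  induction n generalizing f g with
  | zero => exact h
  | succ n ih =>
    intro q hq
    rw [Function.iterate_succ_apply, Function.iterate_succ_apply]
    exact ih (fun r hr => eqOn_dθ hW h hr) q hq

/-- Locality of `D_θ`-iterates on open sets. [folklore] -/
theorem iterate_Dθ_congr_open {f g : ℝ → ℝ → ℝ} {W : Set (ℝ × ℝ)} (hW : IsOpen W) (h : ∀ q ∈ W, f q.1 q.2 = g q.1 q.2) (n : ℕ) :
    ∀ q ∈ W, (Dθ^[n] f) q.1 q.2 = (Dθ^[n] g) q.1 q.2 := by
  induction n generalizing f g with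
  | zero => exact h
  | succ n ih =>
    intro q hq
    rw [Function.iterate_succ_apply, Function.iterate_succ_apply]
    refine ih (fun r hr => ?_) q hq
    show Real.sin (2 * r.2) * dθ f r.1 r.2 = Real.sin (2 * r.2) * dθ g r.1 r.2
    rw [eqOn_dθ hW h hr]

end Elgindi

end Literature.Analysis.FluidPDE
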